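import Mathlib
import HarnessLib
import Summits.Ventures.LatticeQCDFlow.Scoring.SplitChainTourIndependence

/-!
# Tours of the split chain, VIII: the tour pairs as an i.i.d. sequence in Mathlib's vocabulary —
# `iIndepFun` and `IdentDistrib`, from any initial law

HONEST FRAMING: exact (Metropolis-corrected) sampling algorithms for lattice gauge theory;
figures of merit are autocorrelation/cost numbers at stated couplings and volumes; no
continuum-physics claim.

Venture `LatticeQCDFlow` (cell pub-lqcd), topic `Scoring`; FANOUT row 8 (`s0-cpn-nemc`, GEN-18).
NEW WORK of the cell, not a published result; no definition is introduced.  Notation of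
`Scoring/SplitChainTourIndependence.lean`: `T_i = (S^{g₁}_{i+1}, S^{g₂}_{i+1})` the pair of tour sums
of tour `i + 1` for measurable `g₁, g₂ : Ω → ℝ`, `T⁰ = (S^{g₁}_0, S^{g₂}_0)`, `P̂` the split chain of
`κ(x, ·) ≥ ε ν` (`0 < ε < 1`) from any initial law, `P̂_ν̂` the fresh one.  From that file's
factorisation step and one-tour law: the product formula over initial segments by induction, its
extension to arbitrary finite index sets (`univ` at the missing indices), hence
`ProbabilityTheory.iIndepFun (fun i => T_i) P̂`; and `ProbabilityTheory.IdentDistrib T_i T⁰ P̂ P̂_ν̂`,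
`IdentDistrib T_i T_0 P̂ P̂` — exactly the hypotheses of Mathlib's strong law
(`ProbabilityTheory.strong_law_ae_real`) and central limit theorem
(`ProbabilityTheory.tendstoInDistribution_inv_sqrt_mul_sum_sub`), used in
`Scoring/RegenerativeCLT.lean`.  Printed counterpart NAMED ONLY: the i.i.d. tour decomposition of a
split chain (Athreya–Ney 1978; Nummelin 1978; Meyn–Tweedie 1993 Thm 17.3.1) — nothing is cited as a
fact.

## Content (`0 < ε < 1`, any initial law, `g₁ g₂` measurable)

* **`splitChain_tourPairs_measureReal_inter_eq_prod`** —
  `P̂(⋂_{i<n} {T_i ∈ B_i}) = ∏_{i<n} P̂(T_i ∈ B_i)` for measurable `B_i` (real form);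
* **`splitChain_tourPairs_iIndepFun`** — `iIndepFun (fun i => T_i) P̂`;
* **`splitChain_tourPair_identDistrib_fresh`** — `IdentDistrib T_i T⁰ P̂ P̂_ν̂`;
* **`splitChain_tourPair_identDistrib`** — `IdentDistrib T_i T_0 P̂ P̂`.

NOT CLAIMED: tour `0`; two-point tour functionals; any `ε` of a concrete sampler.
-/

noncomputable section

namespace Summit.Ventures.LatticeQCDFlow.Scoring

open MeasureTheory ProbabilityTheory Filter Finset Preorder Literature.Probability.MarkovChains
open scoped ENNReal

section IID

variable {Ω : Type*} [MeasurableSpace Ω]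
  {κ : Kernel Ω Ω} [IsMarkovKernel κ] {ν : Measure Ω} [IsProbabilityMeasure ν] {ε : ℝ≥0∞}
  {hmin : ∀ x {B : Set Ω}, MeasurableSet B → ε * ν B ≤ κ x B}
  (κs : Kernel (Ω × Bool) (Ω × Bool)) [IsMarkovKernel κs]
  (μs : Measure (Ω × Bool)) [IsProbabilityMeasure μs]

/-- **THE PRODUCT FORMULA**: for measurable `B_0, B_1, … ⊆ ℝ × ℝ` and every `n`,
`P̂(⋂_{i<n} {T_i ∈ B_i}) = ∏_{i<n} P̂(T_i ∈ B_i)` (real form). -/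
theorem splitChain_tourPairs_measureReal_inter_eq_prod (hε0 : 0 < ε) (hε : ε < 1)
    (hκs : ∀ p, κs p = (ε • ν).map (fun y : Ω => (y, true))
      + ((1 - ε) • Doeblin.residualKernel κ ν ε hmin p.1).map (fun y : Ω => (y, false)))
    {g₁ g₂ : Ω → ℝ} (hg₁ : Measurable g₁) (hg₂ : Measurable g₂)
    {B : ℕ → Set (ℝ × ℝ)} (hB : ∀ i, MeasurableSet (B i)) :
    ∀ n : ℕ, (Kernel.trajMeasure (X := fun _ : ℕ => Ω × Bool) μs
        (fun m : ℕ => κs.comap (fun h : (i : ↥(Finset.Iic m)) → Ω × Bool =>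
          h ⟨m, Finset.mem_Iic.2 le_rfl⟩) (measurable_pi_apply _))).real
      (⋂ i ∈ Finset.range n, (fun x : ℕ → Ω × Bool =>
        ((∑' u, (if (∑ s ∈ Finset.range u, (if (x (s + 1)).2 then (1 : ℕ) else 0)) = i + 1
            then (1 : ℝ) else 0) * g₁ (x u).1),
          (∑' u, (if (∑ s ∈ Finset.range u, (if (x (s + 1)).2 then (1 : ℕ) else 0)) = i + 1
            then (1 : ℝ) else 0) * g₂ (x u).1))) ⁻¹' B i)
      = ∏ i ∈ Finset.range n, (Kernel.trajMeasure (X := fun _ : ℕ => Ω × Bool) μs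
          (fun m : ℕ => κs.comap (fun h : (i : ↥(Finset.Iic m)) → Ω × Bool =>
            h ⟨m, Finset.mem_Iic.2 le_rfl⟩) (measurable_pi_apply _))).real
        ((fun x : ℕ → Ω × Bool =>
          ((∑' u, (if (∑ s ∈ Finset.range u, (if (x (s + 1)).2 then (1 : ℕ) else 0)) = i + 1
              then (1 : ℝ) else 0) * g₁ (x u).1),
            (∑' u, (if (∑ s ∈ Finset.range u, (if (x (s + 1)).2 then (1 : ℕ) else 0)) = i + 1
              then (1 : ℝ) else 0) * g₂ (x u).1))) ⁻¹' B i)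
  | 0 => by simp
  | n + 1 => by
    rw [splitChain_tourPairs_factorisation κs μs (κ := κ) (ν := ν) (hmin := hmin) hε0 hε hκs hg₁ hg₂
      hB n, splitChain_tourPairs_measureReal_inter_eq_prod hε0 hε hκs hg₁ hg₂ hB n,
      ← splitChain_tourPair_law κs μs (κ := κ) (ν := ν) (hmin := hmin) hε0 hε hκs hg₁ hg₂ (hB n) n,
      Finset.prod_range_succ]

/-- **THE TOUR PAIRS ARE JOINTLY INDEPENDENT**: `iIndepFun (fun i => T_i) P̂` — the sequence
`(S^{g₁}_{i+1}, S^{g₂}_{i+1})_{i ≥ 0}` of tour pairs of the split chain from any initial law is an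
independent family in Mathlib's sense. -/
theorem splitChain_tourPairs_iIndepFun (hε0 : 0 < ε) (hε : ε < 1)
    (hκs : ∀ p, κs p = (ε • ν).map (fun y : Ω => (y, true))
      + ((1 - ε) • Doeblin.residualKernel κ ν ε hmin p.1).map (fun y : Ω => (y, false)))
    {g₁ g₂ : Ω → ℝ} (hg₁ : Measurable g₁) (hg₂ : Measurable g₂) :
    iIndepFun (fun (i : ℕ) (x : ℕ → Ω × Bool) =>
        ((∑' u, (if (∑ s ∈ Finset.range u, (if (x (s + 1)).2 then (1 : ℕ) else 0)) = i + 1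
            then (1 : ℝ) else 0) * g₁ (x u).1),
          (∑' u, (if (∑ s ∈ Finset.range u, (if (x (s + 1)).2 then (1 : ℕ) else 0)) = i + 1
            then (1 : ℝ) else 0) * g₂ (x u).1)))
      (Kernel.trajMeasure (X := fun _ : ℕ => Ω × Bool) μs
        (fun m : ℕ => κs.comap (fun h : (i : ↥(Finset.Iic m)) → Ω × Bool =>
          h ⟨m, Finset.mem_Iic.2 le_rfl⟩) (measurable_pi_apply _))) := by
  set P := Kernel.trajMeasure (X := fun _ : ℕ => Ω × Bool) μs
      (fun m : ℕ => κs.comap (fun h : (i : ↥(Finset.Iic m)) → Ω × Bool =>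
        h ⟨m, Finset.mem_Iic.2 le_rfl⟩) (measurable_pi_apply _)) with hP
  set T : ℕ → (ℕ → Ω × Bool) → ℝ × ℝ := fun a x =>
      ((∑' u, (if (∑ s ∈ Finset.range u, (if (x (s + 1)).2 then (1 : ℕ) else 0)) = a
          then (1 : ℝ) else 0) * g₁ (x u).1),
        (∑' u, (if (∑ s ∈ Finset.range u, (if (x (s + 1)).2 then (1 : ℕ) else 0)) = a
          then (1 : ℝ) else 0) * g₂ (x u).1)) with hT
  change iIndepFun (fun i => T (i + 1)) P
  rw [iIndepFun_iff_measure_inter_preimage_eq_mul]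
  intro S sets hsets
  -- embed `S` in an initial segment `range n` with `univ` at the missing indices
  set n : ℕ := S.sup id + 1 with hn
  have hlt : ∀ i ∈ S, i < n := fun i hi =>
    Nat.lt_succ_of_le (Finset.le_sup (f := id) hi)
  classical
  set B : ℕ → Set (ℝ × ℝ) := fun i => if i ∈ S then sets i else Set.univ with hBdef
  have hB : ∀ i, MeasurableSet (B i) := fun i => by
    by_cases hi : i ∈ S
    · simp only [hBdef, hi, if_true]; exact hsets i hi
    · simp only [hBdef, hi, if_false]; exact MeasurableSet.univ
  have hset : (⋂ i ∈ S, (T (i + 1)) ⁻¹' sets i) = ⋂ i ∈ Finset.range n, (T (i + 1)) ⁻¹' B i := by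
    ext x
    simp only [Set.mem_iInter, Set.mem_preimage, Finset.mem_range, hBdef]
    constructor
    · intro hx i _
      by_cases hi : i ∈ S
      · rw [if_pos hi]; exact hx i hi
      · rw [if_neg hi]; exact Set.mem_univ _
    · intro hx i hi
      have := hx i (hlt i hi)
      rwa [if_pos hi] at this
  have hprod : ∏ i ∈ Finset.range n, P ((T (i + 1)) ⁻¹' B i) = ∏ i ∈ S, P ((T (i + 1)) ⁻¹' sets i) := by
    rw [← Finset.prod_subset (fun i hi => Finset.mem_range.2 (hlt i hi))
      (fun i _ hi => by simp only [hBdef, hi, if_false, Set.preimage_univ, measure_univ])]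
    exact Finset.prod_congr rfl fun i hi => by simp only [hBdef, hi, if_true]
  have hreal := splitChain_tourPairs_measureReal_inter_eq_prod κs μs (κ := κ) (ν := ν) (hmin := hmin)
    hε0 hε hκs hg₁ hg₂ hB n
  rw [← hP] at hreal
  change P.real (⋂ i ∈ Finset.range n, (T (i + 1)) ⁻¹' B i)
    = ∏ i ∈ Finset.range n, P.real ((T (i + 1)) ⁻¹' B i) at hreal
  simp only [measureReal_def] at hreal
  rw [← ENNReal.toReal_prod] at hreal
  rw [hset, ← hprod]
  exact (ENNReal.toReal_eq_toReal_iff' (measure_ne_top _ _)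
    (ENNReal.prod_lt_top fun i _ => measure_lt_top _ _).ne).1 hreal

/-- **EVERY LATER TOUR PAIR IS DISTRIBUTED AS THE FRESH FIRST-TOUR PAIR**:
`IdentDistrib T_i T⁰ P̂ P̂_ν̂`. -/
theorem splitChain_tourPair_identDistrib_fresh (hε0 : 0 < ε) (hε : ε < 1)
    (hκs : ∀ p, κs p = (ε • ν).map (fun y : Ω => (y, true))
      + ((1 - ε) • Doeblin.residualKernel κ ν ε hmin p.1).map (fun y : Ω => (y, false)))
    {g₁ g₂ : Ω → ℝ} (hg₁ : Measurable g₁) (hg₂ : Measurable g₂) (i : ℕ) :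
    IdentDistrib (fun x : ℕ → Ω × Bool =>
        ((∑' u, (if (∑ s ∈ Finset.range u, (if (x (s + 1)).2 then (1 : ℕ) else 0)) = i + 1
            then (1 : ℝ) else 0) * g₁ (x u).1),
          (∑' u, (if (∑ s ∈ Finset.range u, (if (x (s + 1)).2 then (1 : ℕ) else 0)) = i + 1
            then (1 : ℝ) else 0) * g₂ (x u).1)))
      (fun y : ℕ → Ω × Bool =>
        ((∑' u, (if (∑ s ∈ Finset.range u, (if (y (s + 1)).2 then (1 : ℕ) else 0)) = 0
            then (1 : ℝ) else 0) * g₁ (y u).1),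
          (∑' u, (if (∑ s ∈ Finset.range u, (if (y (s + 1)).2 then (1 : ℕ) else 0)) = 0
            then (1 : ℝ) else 0) * g₂ (y u).1)))
      (Kernel.trajMeasure (X := fun _ : ℕ => Ω × Bool) μs
        (fun m : ℕ => κs.comap (fun h : (i : ↥(Finset.Iic m)) → Ω × Bool =>
          h ⟨m, Finset.mem_Iic.2 le_rfl⟩) (measurable_pi_apply _)))
      (Kernel.trajMeasure (X := fun _ : ℕ => Ω × Bool) (ν.map (fun y : Ω => (y, true)))
        (fun m : ℕ => κs.comap (fun h : (i : ↥(Finset.Iic m)) → Ω × Bool =>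
          h ⟨m, Finset.mem_Iic.2 le_rfl⟩) (measurable_pi_apply _))) := by
  haveI hνt : IsProbabilityMeasure (ν.map (fun y : Ω => (y, true))) :=
    Measure.isProbabilityMeasure_map (measurable_tagCoin true).aemeasurable
  refine ⟨(measurable_tourPair hg₁ hg₂ (i + 1)).aemeasurable,
    (measurable_tourPair hg₁ hg₂ 0).aemeasurable, Measure.ext fun S hS => ?_⟩
  rw [Measure.map_apply (measurable_tourPair hg₁ hg₂ (i + 1)) hS,
    Measure.map_apply (measurable_tourPair hg₁ hg₂ 0) hS]
  have h := splitChain_tourPair_law κs μs (κ := κ) (ν := ν) (hmin := hmin) hε0 hε hκs hg₁ hg₂ hS i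
  simp only [measureReal_def] at h
  exact (ENNReal.toReal_eq_toReal_iff' (measure_ne_top _ _) (measure_ne_top _ _)).1 h

/-- **THE TOUR PAIRS ARE IDENTICALLY DISTRIBUTED**: `IdentDistrib T_i T_0 P̂ P̂` for every `i`
(the form Mathlib's strong law and central limit theorem take). -/
theorem splitChain_tourPair_identDistrib (hε0 : 0 < ε) (hε : ε < 1)
    (hκs : ∀ p, κs p = (ε • ν).map (fun y : Ω => (y, true))
      + ((1 - ε) • Doeblin.residualKernel κ ν ε hmin p.1).map (fun y : Ω => (y, false)))
    {g₁ g₂ : Ω → ℝ} (hg₁ : Measurable g₁) (hg₂ : Measurable g₂) (i : ℕ) :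
    IdentDistrib (fun x : ℕ → Ω × Bool =>
        ((∑' u, (if (∑ s ∈ Finset.range u, (if (x (s + 1)).2 then (1 : ℕ) else 0)) = i + 1
            then (1 : ℝ) else 0) * g₁ (x u).1),
          (∑' u, (if (∑ s ∈ Finset.range u, (if (x (s + 1)).2 then (1 : ℕ) else 0)) = i + 1
            then (1 : ℝ) else 0) * g₂ (x u).1)))
      (fun x : ℕ → Ω × Bool =>
        ((∑' u, (if (∑ s ∈ Finset.range u, (if (x (s + 1)).2 then (1 : ℕ) else 0)) = 0 + 1
            then (1 : ℝ) else 0) * g₁ (x u).1),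
          (∑' u, (if (∑ s ∈ Finset.range u, (if (x (s + 1)).2 then (1 : ℕ) else 0)) = 0 + 1
            then (1 : ℝ) else 0) * g₂ (x u).1)))
      (Kernel.trajMeasure (X := fun _ : ℕ => Ω × Bool) μs
        (fun m : ℕ => κs.comap (fun h : (i : ↥(Finset.Iic m)) → Ω × Bool =>
          h ⟨m, Finset.mem_Iic.2 le_rfl⟩) (measurable_pi_apply _)))
      (Kernel.trajMeasure (X := fun _ : ℕ => Ω × Bool) μs
        (fun m : ℕ => κs.comap (fun h : (i : ↥(Finset.Iic m)) → Ω × Bool =>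
          h ⟨m, Finset.mem_Iic.2 le_rfl⟩) (measurable_pi_apply _))) :=
  (splitChain_tourPair_identDistrib_fresh κs μs (κ := κ) (ν := ν) (hmin := hmin) hε0 hε hκs hg₁ hg₂
    i).trans
    (splitChain_tourPair_identDistrib_fresh κs μs (κ := κ) (ν := ν) (hmin := hmin) hε0 hε hκs hg₁
      hg₂ 0).symm

end IID

end Summit.Ventures.LatticeQCDFlow.Scoring

end
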